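import Mathlib
import HarnessLib
import Literature.Probability.MarkovChains.MarkovChainDecomposition
import Literature.Probability.MarkovChains.AsymptoticVarianceSpectral

/-!
HONEST FRAMING: exact (Metropolis-corrected) sampling algorithms for lattice gauge theory; figures
of merit are autocorrelation/cost numbers at stated couplings and volumes; no continuum-physics
claim.

# LadderFloor — THE GENERIC LADDER FLOOR: a finite reversible chain fibred over the ladder `0,…,K` with equal
# block masses, no flow between non-adjacent blocks and adjacent flows `≤ C` keeps the block index correlated
# for `τ_int(level) ≥ (K+2)/(12C) − ½` steps, whatever happens inside the blocks (lean-2 GEN-16, ours)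

Venture-side (OURS).  Cell `lqcd-flow` (pub-lqcd), unit `pub-lqcd-lean-2-g16`, 2026-08-24.  The abstract core
of the FLOORS of chapter X (`Scaling/SimulatedTemperingFiniteFloor`, `Scaling/ReplicaExchangeFiniteFloor`), the
companion of `Scaling/LadderDecomposition` (the ceilings), in the vocabulary of the Literature's
Jerrum–Son–Tetali–Vigoda file (`block`, `blockMass`, `blockFlow`).  For a function of the block index the
Dirichlet form of `P` only sees the inter-block flows (`dirichletForm_comp_blk`), its variance is that of the
block law (`lawVariance_comp_blk`); on a ladder whose blocks have mass `1/(K+1)`, exchange mass only between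
neighbours and at most `C` per adjacent pair, the level has `Var = K(K+2)/12` and `𝓔 ≤ K·C`, and the
Madras–Slade bound `τ_int ≥ 1/(1 − ρ(1)) − ½ = Var/𝓔 − ½` (Literature `asympVar_mul_dirichletForm_ge`, (9.2.28),
PROVED there) gives the floor.

* `dirichletForm_comp_blk` — `𝓔_π(P; g∘blk) = ½ Σ_i Σ_j blockFlow(i,j)(g i − g j)²`;
  `lawMean_comp_blk`, `lawVariance_comp_blk` — `Var_π(g∘blk) = Var_π̄(g)`;
  **`lawVariance_uniform_level`** — `Var_unif(k ↦ k) = K(K+2)/12` on `Fin (K+1)`.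
* **`ladder_dirichletForm_level_le`** — no flow beyond neighbours, adjacent flows `≤ C` (and symmetric) ⇒
  `𝓔_π(P; level) ≤ K·C`.
* **`ladder_tauInt_level_ge`** — `π > 0` reversible irreducible, masses `1/(K+1)`, `K ≥ 1`, `C > 0` ⇒
  **`asympVar(level)/(2·Var(level)) ≥ (K+2)/(12C) − ½`**.  Instances: simulated tempering `C = t/(2(K+1))`
  (`⇒ (K+1)(K+2)/(6t) − ½`), replica exchange `C = t/(K(K+1))` (`⇒ K(K+1)(K+2)/(12t) − ½`).

NOT CLAIMED: floors for observables other than the block index; anything measured.  Literature grade (cell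
rule): KNOWN MECHANISM (Madras–Slade Prop. 9.2.2 / Cor. 9.2.3: an observable moving one rung at a time with
small flow decorrelates slowly), NEW TYPING; nothing cited as a fact; no new bib keys.
-/

noncomputable section

open Finset
open scoped Matrix
open Literature.Probability.MarkovChains
open Literature.Probability.MarkovChains.Decomposition

namespace Summit.Ventures.LatticeQCDFlow.Scaling

/-! ## §1 Functions of the block index -/

section Block

variable {X I : Type*} [Fintype X] [Fintype I] [DecidableEq I] {π : X → ℝ} {P : Matrix X X ℝ} {blk : X → I}

omit [DecidableEq I] in
/-- **The Dirichlet form of a function of the block index only sees the inter-block flows:**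
`𝓔_π(P; g∘blk) = ½ Σ_i Σ_j blockFlow(i,j)·(g i − g j)²`. [ours] -/
theorem dirichletForm_comp_blk [DecidableEq I] (π : X → ℝ) (P : Matrix X X ℝ) (blk : X → I) (g : I → ℝ) :
    dirichletForm π P (fun x => g (blk x)) = 1 / 2 * ∑ i, ∑ j, blockFlow π P blk i j * (g i - g j) ^ 2 := by
  unfold dirichletForm blockFlow
  congr 1
  rw [sum_eq_sum_block blk]
  refine sum_congr rfl fun i _ => ?_
  -- inner sum over `y`, grouped by blocks
  have h : ∀ x ∈ block blk i, ∑ y, π x * P x y * (g (blk x) - g (blk y)) ^ 2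
      = ∑ j, ∑ y ∈ block blk j, π x * P x y * (g i - g j) ^ 2 := by
    intro x hx
    rw [sum_eq_sum_block blk]
    refine sum_congr rfl fun j _ => sum_congr rfl fun y hy => ?_
    rw [mem_block.mp hx, mem_block.mp hy]
  rw [sum_congr rfl h, Finset.sum_comm]
  refine sum_congr rfl fun j _ => ?_
  rw [Finset.sum_mul]
  refine sum_congr rfl fun x _ => ?_
  rw [Finset.sum_mul]

/-- The mean of a function of the block index is its mean under the block masses. [ours] -/
theorem lawMean_comp_blk (π : X → ℝ) (blk : X → I) (g : I → ℝ) :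
    lawMean π (fun x => g (blk x)) = lawMean (blockMass π blk) g := by
  unfold lawMean blockMass
  rw [sum_eq_sum_block blk]
  refine sum_congr rfl fun i _ => ?_
  rw [Finset.sum_mul]
  exact sum_congr rfl fun x hx => by simp only [mem_block.mp hx]

/-- **The variance of a function of the block index is its variance under the block masses.** [ours] -/
theorem lawVariance_comp_blk (π : X → ℝ) (blk : X → I) (g : I → ℝ) :
    lawVariance π (fun x => g (blk x)) = lawVariance (blockMass π blk) g := by
  unfold lawVariance
  rw [lawMean_comp_blk, sum_eq_sum_block blk]
  unfold blockMass
  refine sum_congr rfl fun i _ => ?_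
  rw [Finset.sum_mul]
  exact sum_congr rfl fun x hx => by simp only [mem_block.mp hx]

end Block

/-! ## §2 The ladder: variance of the level, Dirichlet form of the level -/

/-- **`Var_unif(level) = K(K+2)/12`** for the uniform law on `0, …, K`. [folklore] -/
theorem lawVariance_uniform_level (K : ℕ) :
    lawVariance (fun _ : Fin (K + 1) => (1 : ℝ) / (K + 1)) (fun k => (k : ℝ)) = K * (K + 2) / 12 := by
  -- `Σ_{i<n} i = n(n−1)/2`, `Σ_{i<n} i² = n(n−1)(2n−1)/6` (real forms, by induction)
  have sum_id : ∀ n : ℕ, ∑ i ∈ Finset.range n, (i : ℝ) = n * (n - 1) / 2 := by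
    intro n
    induction n with
    | zero => simp
    | succ n ih => rw [Finset.sum_range_succ, ih]; push_cast; ring
  have sum_sq : ∀ n : ℕ, ∑ i ∈ Finset.range n, (i : ℝ) ^ 2 = n * (n - 1) * (2 * n - 1) / 6 := by
    intro n
    induction n with
    | zero => simp
    | succ n ih => rw [Finset.sum_range_succ, ih]; push_cast; ring
  unfold lawVariance lawMean
  have h1 : ∑ k : Fin (K + 1), (1 : ℝ) / (K + 1) * (k : ℝ) = K / 2 := by
    rw [← Finset.mul_sum, Fin.sum_univ_eq_sum_range (fun i => (i : ℝ)) (K + 1), sum_id]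
    push_cast
    field_simp
    ring
  rw [h1, ← Finset.mul_sum]
  have h2 : ∑ k : Fin (K + 1), ((k : ℝ) - K / 2) ^ 2
      = ∑ k : Fin (K + 1), ((k : ℝ) ^ 2 - K * (k : ℝ) + (K : ℝ) ^ 2 / 4) :=
    sum_congr rfl fun k _ => by ring
  rw [h2, Finset.sum_add_distrib, Finset.sum_sub_distrib, ← Finset.mul_sum,
    Fin.sum_univ_eq_sum_range (fun i => (i : ℝ) ^ 2) (K + 1),
    Fin.sum_univ_eq_sum_range (fun i => (i : ℝ)) (K + 1), sum_sq, sum_id,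
    Finset.sum_const, Finset.card_univ, Fintype.card_fin, nsmul_eq_mul]
  push_cast
  field_simp
  ring

section Ladder

variable {X : Type*} [Fintype X] [DecidableEq X] {K : ℕ} {π : X → ℝ} {P : Matrix X X ℝ} {blk : X → Fin (K + 1)}

omit [DecidableEq X] in
/-- **The Dirichlet form of the level on a ladder:** no flow between non-adjacent blocks and adjacent flows
`≤ C` in both directions ⇒ `𝓔_π(P; level) ≤ K·C`. [ours] -/
theorem ladder_dirichletForm_level_le (hF0 : ∀ i j, 0 ≤ blockFlow π P blk i j) {C : ℝ}
    (hfar : ∀ i j : Fin (K + 1), i ≠ j → ¬ (j.val = i.val + 1 ∨ i.val = j.val + 1) → blockFlow π P blk i j = 0)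
    (hup : ∀ j : Fin K, blockFlow π P blk j.castSucc j.succ ≤ C)
    (hdown : ∀ j : Fin K, blockFlow π P blk j.succ j.castSucc ≤ C) :
    dirichletForm π P (fun x => ((blk x : ℕ) : ℝ)) ≤ K * C := by
  rw [dirichletForm_comp_blk π P blk (fun i => ((i : ℕ) : ℝ))]
  -- termwise: the flow term is `≤ C·([j = i+1] + [i = j+1])`
  have hterm : ∀ i j : Fin (K + 1), blockFlow π P blk i j * (((i : ℕ) : ℝ) - ((j : ℕ) : ℝ)) ^ 2
      ≤ (if j.val = i.val + 1 then C else 0) + (if i.val = j.val + 1 then C else 0) := by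
    intro i j
    by_cases hij : i = j
    · subst hij; simp
    by_cases h1 : j.val = i.val + 1
    · have hj : i.val < K := by have := j.2; omega
      have e1 : i = (⟨i.val, hj⟩ : Fin K).castSucc := Fin.ext (by simp)
      have e2 : j = (⟨i.val, hj⟩ : Fin K).succ := Fin.ext (by simp; omega)
      have hsq : (((i : ℕ) : ℝ) - ((j : ℕ) : ℝ)) ^ 2 = 1 := by
        rw [h1]; push_cast; ring
      rw [if_pos h1, if_neg (by omega), add_zero, hsq, mul_one]
      have := hup ⟨i.val, hj⟩
      rwa [← e1, ← e2] at this
    by_cases h2 : i.val = j.val + 1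
    · have hj : j.val < K := by have := i.2; omega
      have e1 : j = (⟨j.val, hj⟩ : Fin K).castSucc := Fin.ext (by simp)
      have e2 : i = (⟨j.val, hj⟩ : Fin K).succ := Fin.ext (by simp; omega)
      have hsq : (((i : ℕ) : ℝ) - ((j : ℕ) : ℝ)) ^ 2 = 1 := by
        rw [h2]; push_cast; ring
      rw [if_neg h1, if_pos h2, zero_add, hsq, mul_one]
      have := hdown ⟨j.val, hj⟩
      rwa [← e1, ← e2] at this
    · rw [hfar i j hij (fun h => h.elim h1 h2), zero_mul, if_neg h1, if_neg h2, add_zero]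
  have hsum := Finset.sum_le_sum fun i (_ : i ∈ (univ : Finset (Fin (K + 1)))) =>
    Finset.sum_le_sum fun j (_ : j ∈ (univ : Finset (Fin (K + 1)))) => hterm i j
  have hR : ∑ i : Fin (K + 1), ∑ j : Fin (K + 1),
      ((if j.val = i.val + 1 then C else 0) + (if i.val = j.val + 1 then C else 0)) = 2 * (K * C) := by
    simp_rw [Finset.sum_add_distrib]
    have h1 := sum_sum_ite_val_succ' (K := K) C
    have h2 := sum_sum_ite_val_pred' (K := K) C
    rw [h1, h2]; ring
  have hC : 0 ≤ K * C := by
    rcases Nat.eq_zero_or_pos K with hK | hK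
    · subst hK; simp
    · have := hup ⟨0, hK⟩
      have h0 := hF0 ((⟨0, hK⟩ : Fin K).castSucc) ((⟨0, hK⟩ : Fin K).succ)
      exact mul_nonneg (Nat.cast_nonneg K) (h0.trans this)
  calc 1 / 2 * ∑ i : Fin (K + 1), ∑ j : Fin (K + 1), blockFlow π P blk i j * (((i : ℕ) : ℝ) - ((j : ℕ) : ℝ)) ^ 2
      ≤ 1 / 2 * (2 * (K * C)) := mul_le_mul_of_nonneg_left (hsum.trans_eq hR) (by norm_num)
    _ = K * C := by ring
  where
  /-- `Σ_i Σ_j [j = i+1]·C = K·C`. -/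
  sum_sum_ite_val_succ' {K : ℕ} (C : ℝ) :
      ∑ i : Fin (K + 1), ∑ j : Fin (K + 1), (if j.val = i.val + 1 then C else 0) = K * C := by
    rw [Finset.sum_comm, Fin.sum_univ_succ]
    have h0 : ∑ i : Fin (K + 1), (if (0 : Fin (K + 1)).val = i.val + 1 then C else 0) = 0 :=
      Finset.sum_eq_zero fun i _ => by rw [if_neg (by simp)]
    rw [h0, zero_add]
    have hk : ∀ k : Fin K, ∑ i : Fin (K + 1), (if k.succ.val = i.val + 1 then C else 0) = C := by
      intro k
      have hc : ∀ i : Fin (K + 1), (k.succ.val = i.val + 1) ↔ (i = k.castSucc) := by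
        intro i; rw [Fin.ext_iff, Fin.val_succ, Fin.val_castSucc]; omega
      rw [Finset.sum_congr rfl fun i _ => if_congr (hc i) rfl rfl, Finset.sum_ite_eq' univ k.castSucc,
        if_pos (mem_univ _)]
    simp_rw [hk]
    simp
  /-- `Σ_i Σ_j [i = j+1]·C = K·C`. -/
  sum_sum_ite_val_pred' {K : ℕ} (C : ℝ) :
      ∑ i : Fin (K + 1), ∑ j : Fin (K + 1), (if i.val = j.val + 1 then C else 0) = K * C := by
    rw [Finset.sum_comm]
    exact sum_sum_ite_val_succ' C

/-- **THE GENERIC LADDER FLOOR.**  `π > 0` a probability vector, `P` row-stochastic, `π`-reversible and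
irreducible, block masses `1/(K+1)`, no flow between non-adjacent blocks, adjacent flows `≤ C` (both directions),
`K ≥ 1`, `C > 0` ⇒ **`asympVar(level)/(2·Var(level)) ≥ (K+2)/(12C) − ½`**: the block index stays correlated for
`Ω(K/C)` steps whatever the dynamics inside the blocks. [ours] -/
theorem ladder_tauInt_level_ge (hK : 1 ≤ K) (hπ : ∀ x, 0 < π x) (hπ1 : ∑ x, π x = 1)
    (hP : IsRowStochastic P) (hDB : DetailedBalance π P) (hirr : IsIrreducible P)
    (hmass : ∀ i, blockMass π blk i = 1 / (K + 1)) {C : ℝ} (hC : 0 < C)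
    (hfar : ∀ i j : Fin (K + 1), i ≠ j → ¬ (j.val = i.val + 1 ∨ i.val = j.val + 1) → blockFlow π P blk i j = 0)
    (hup : ∀ j : Fin K, blockFlow π P blk j.castSucc j.succ ≤ C)
    (hdown : ∀ j : Fin K, blockFlow π P blk j.succ j.castSucc ≤ C) :
    (K + 2) / (12 * C) - 1 / 2
      ≤ asympVar (fun x => ((blk x : ℕ) : ℝ)) π P / (2 * lawVariance π (fun x => ((blk x : ℕ) : ℝ))) := by
  have hst : IsStationary π P := hDB.isStationary hP.2
  have key := asympVar_mul_dirichletForm_ge hπ hπ1 hP hDB hirr (fun x => ((blk x : ℕ) : ℝ))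
  have h928 := MadrasSlade1993_eq_9_2_28 hP hst (fun x => ((blk x : ℕ) : ℝ))
  set V := lawVariance π (fun x => ((blk x : ℕ) : ℝ)) with hV
  set C1 := piInner π (centred π (fun x => ((blk x : ℕ) : ℝ))) (P *ᵥ centred π (fun x => ((blk x : ℕ) : ℝ)))
    with hC1
  set v := asympVar (fun x => ((blk x : ℕ) : ℝ)) π P with hv
  have hVval : V = K * (K + 2) / 12 := by
    rw [hV, lawVariance_comp_blk π blk (fun i => ((i : ℕ) : ℝ)), funext hmass]
    exact lawVariance_uniform_level K
  have hE : V - C1 ≤ K * C := by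
    rw [h928]
    exact ladder_dirichletForm_level_le (blockFlow_nonneg (fun x => (hπ x).le) hP.1 blk) hfar hup hdown
  have hKr : (1 : ℝ) ≤ K := by exact_mod_cast hK
  have hVpos : 0 < V := by rw [hVval]; positivity
  -- the Dirichlet form is positive, or `key` would read `2V² ≤ 0`
  have hEpos : 0 < V - C1 := by
    by_contra h
    push Not at h
    have hE0 : V - C1 = 0 := le_antisymm h (by rw [h928]; exact dirichletForm_nonneg (fun x => (hπ x).le) hP.1 _)
    have : V * (V + C1) ≤ 0 := by rw [show V - C1 = 0 from hE0, mul_zero] at key; exact key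
    nlinarith
  -- `v/(2V) ≥ V/(V − C1) − ½ ≥ V/(KC) − ½ = (K+2)/(12C) − ½`
  have hEne : V - C1 ≠ 0 := hEpos.ne'
  have h1 : (K + 2 : ℝ) / (12 * C) = V / (K * C) := by
    rw [hVval]; field_simp
  have h2 : V / (K * C) ≤ V / (V - C1) := div_le_div_of_nonneg_left hVpos.le hEpos hE
  have h3 : V / (V - C1) - 1 / 2 ≤ v / (2 * V) := by
    have e : V / (V - C1) - 1 / 2 = (2 * V - (V - C1)) / (2 * (V - C1)) := by field_simp
    rw [e, div_le_div_iff₀ (by positivity) (by positivity)]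
    nlinarith [key]
  linarith

end Ladder

end Summit.Ventures.LatticeQCDFlow.Scaling

end
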